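import Literature.MathematicalPhysics.QuantumLattice.HubbardUVSymbolDressingFactorJetsGevrey
import Literature.Analysis.Calculus.IteratedDerivCompDiffGevrey
import HarnessLib

/-!
# The single-scale DEFECT `d = Ψ̃ − Ψ₁` of the mismatch-resummed two-leg reading carries the size of the frame shift:
# `‖Dⁿ d(p)‖ ≤ δ·K·(n!)²·ρ_dⁿ` in the last-scale regime `Λ/4 ≤ |ω|`

Topic `MathematicalPhysics/QuantumLattice`; the δ-CARRYING companion of `HubbardUVSymbolDressingFactorJetsGevrey.norm_iteratedFDeriv_defect_le_gevrey`,
which bounds the defect `d = w(u)·R(u + w(u)v) − w(u+v)·R(u+v)` (`w = χ₂((ω²+·²)/Λ²)` the ultraviolet weight, `R(ξ) = c/(−iω+ξ)` the resolvent,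
`u` the new band, `v` the frame mismatch with `‖Dⁱv‖ ≤ δ·i!·F_vⁱ`) by the TRIANGLE bound `‖DⁿΨ̃‖ + ‖DⁿΨ₁‖` — no factor `δ` although `d = O(v)`.
At the last flow step of the Hubbard `KLProgramme` (cell gate-hubbard-kl, located finding «(C)-B-LAST-SIZE») the Leibniz rows of the frame-response door
need that factor.  Writing
  `d = w(u)·[R(u + w(u)v) − R(u+v)] + [w(u) − w(u+v)]·R(u+v)`
both brackets are DIFFERENCES OF COMPOSITIONS with the same Gevrey outer function (`R`, resp. `w`) and nearby inner bands, whose difference is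
`(w(u) − 1)·v` resp. `−v` — so `Literature.Analysis.Calculus.norm_iteratedFDeriv_comp_sub_comp_le_of_gevrey_two` gives each ONE factor `δ`; in the
last-scale regime `Λ/4 ≤ |ω|` (thermal layer: `|ω| = π/β`, `Λ_{n_β} ∈ [π/β, 4π/β)`) the resolvent has GLOBAL Gevrey sup jets `|c|(4/Λ)·(k!)²·(4/Λ)ᵏ`
(Benfatto–Giuliani–Mastropietro 2006 §2.3 (2.27)–(2.28), (2.36aa); the Gevrey cutoff class of Disertori–Rivasseau 2000 App. A).

* `sq_factorial_succ_le` — `((n+1)!)² ≤ (n!)²·4ⁿ`;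
* `norm_iteratedFDeriv_resolventFnXi_le_gevrey_of_freq` — `Λ/4 ≤ |ω| ⇒ ‖DᵏR(ξ)‖ ≤ |c|(4/Λ)·(k!)²·(4/Λ)ᵏ` everywhere;
* **`norm_iteratedFDeriv_defect_le_gevrey_small`** — `‖Dⁿd(p)‖ ≤ δ·X₀|c|(4/Λ)((X₀+1)(4/Λ) + 16(1+C_χ)/Λ)·(n!)²·(2ρ_d)ⁿ` with the explicit ratio
  `ρ_d = 4θ_A + 4θ_B + θ_R + ρ₁` (`ρ₁ = 4E_u(1+16(1+C_χ)/Λ) + F_v`, `θ_A = 4(E_u+F_v)(1+(16(1+C_χ)/Λ)(1+δ))`,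
  `θ_B = 8ρ₁(1 + (4/Λ)(1+δ+Λ/128+X₀δ))`, `θ_R = 4(E_u+F_v)(1+(4/Λ)(1+δ))`).

Everything is proved; no definitions; no named facts.

## Sources

G. Benfatto, A. Giuliani, V. Mastropietro, Ann. Henri Poincaré 7 (2006) 809–898, §2.3 (2.23), (2.27)–(2.28), (2.36aa) [`BenfattoGiulianiMastropietro2006`];
M. Disertori, V. Rivasseau, Commun. Math. Phys. 215 (2000) 251–290, App. A Lemma 11 [`DisertoriRivasseau2000`].
-/

noncomputable section

namespace Literature.MathematicalPhysics.QuantumLattice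

open Complex Finset Literature.Analysis.Calculus
open scoped Nat

variable {c Λ ω : ℝ}

/-- `((n+1)!)² ≤ (n!)²·4ⁿ` (`n + 1 ≤ 2ⁿ`). [cite: BenfattoGiulianiMastropietro2006, §3 (3.2)] -/
theorem sq_factorial_succ_le (n : ℕ) : (((n + 1) ! : ℕ) : ℝ) ^ 2 ≤ ((n ! : ℝ)) ^ 2 * 4 ^ n := by
  have h1 : n + 1 ≤ 2 ^ n := Nat.lt_two_pow_self
  have h2 : ((n + 1 : ℕ) : ℝ) ≤ (2 : ℝ) ^ n := by exact_mod_cast h1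
  rw [Nat.factorial_succ, Nat.cast_mul, mul_pow]
  have h4 : ((n + 1 : ℕ) : ℝ) ^ 2 ≤ (4 : ℝ) ^ n := by
    calc ((n + 1 : ℕ) : ℝ) ^ 2 ≤ ((2 : ℝ) ^ n) ^ 2 := pow_le_pow_left₀ (by positivity) h2 2
      _ = (4 : ℝ) ^ n := by rw [← pow_mul, mul_comm, pow_mul]; norm_num
  calc ((n + 1 : ℕ) : ℝ) ^ 2 * ((n ! : ℝ)) ^ 2 ≤ (4 : ℝ) ^ n * ((n ! : ℝ)) ^ 2 := mul_le_mul_of_nonneg_right h4 (by positivity)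
    _ = ((n ! : ℝ)) ^ 2 * 4 ^ n := by ring

/-- **Global Gevrey sup jets of the resolvent in the last-scale regime**: `Λ/4 ≤ |ω|` (`0 < Λ`) gives, for every `ξ` and `k`,
`‖DᵏR(ξ)‖ ≤ |c|(4/Λ)·(k!)²·(4/Λ)ᵏ` (`‖DᵏR(ξ)‖ = |c|k!/|−iω+ξ|^{k+1} ≤ |c|k!/|ω|^{k+1}`). [cite: BenfattoGiulianiMastropietro2006, §2.3 (2.36aa)] -/
theorem norm_iteratedFDeriv_resolventFnXi_le_gevrey_of_freq (hΛ : 0 < Λ) (hωΛ : Λ / 4 ≤ |ω|) (k : ℕ) (ξ : ℝ) :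
    ‖iteratedFDeriv ℝ k (resolventFnXi c 0 ω) ξ‖ ≤ |c| * (4 / Λ) * ((k ! : ℝ)) ^ 2 * (4 / Λ) ^ k := by
  have hωpos : 0 < |ω| := lt_of_lt_of_le (by positivity) hωΛ
  have hω0 : ω + 0 ≠ 0 := by rw [add_zero]; exact abs_pos.1 hωpos
  refine (norm_iteratedFDeriv_resolventFnXi_le (c := c) hω0 k ξ).trans ?_
  rw [add_zero]
  have hinv : |ω|⁻¹ ≤ 4 / Λ := by rw [inv_le_comm₀ hωpos (by positivity), inv_div]; exact hωΛ
  have hfac : (k ! : ℝ) ≤ ((k ! : ℝ)) ^ 2 := by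
    rw [sq]; exact le_mul_of_one_le_left (by positivity) (by exact_mod_cast Nat.one_le_iff_ne_zero.2 (Nat.factorial_ne_zero k))
  calc |c| * (k ! : ℝ) / |ω| ^ (k + 1) = |c| * (k ! : ℝ) * (|ω|⁻¹) ^ (k + 1) := by rw [div_eq_mul_inv, inv_pow]
    _ ≤ |c| * ((k ! : ℝ)) ^ 2 * (4 / Λ) ^ (k + 1) := by gcongr
    _ = |c| * (4 / Λ) * ((k ! : ℝ)) ^ 2 * (4 / Λ) ^ k := by rw [pow_succ]; ring

section Jets

variable {E : Type} [NormedAddCommGroup E] [NormedSpace ℝ E]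

/-- **THE δ-CARRYING DEFECT JETS (last-scale regime `Λ/4 ≤ |ω|`).**  With `u, v : E → ℝ` smooth, `‖Dⁱu(p)‖ ≤ i!·E_uⁱ` (`1 ≤ i ≤ n`),
`‖Dⁱv(p)‖ ≤ δ·i!·F_vⁱ` (`i ≤ n`), the Gevrey table `‖χ₂^{(l)}‖ ≤ X₀(l!)²C_χ^l` for `l ≤ n+1`, `1 ≤ X₀`, `0 ≤ C_χ`, `0 < Λ`, `Λ/4 ≤ |ω|`:
`‖Dⁿ[w(u)·R(u + w(u)v) − Ψ(u+v)](p)‖ ≤ δ·(X₀·(|c|(4/Λ))·((X₀+1)(4/Λ) + 16(1+C_χ)/Λ))·(n!)²·(2ρ_d)ⁿ`,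
`ρ_d = 4θ_A + 4θ_B + θ_R + ρ₁` as in the module docstring — ONE factor `δ` (the size of the frame shift).
[cite: BenfattoGiulianiMastropietro2006, §2.3 (2.27)–(2.28)] -/
theorem norm_iteratedFDeriv_defect_le_gevrey_small (hΛ : 0 < Λ) (hωΛ : Λ / 4 ≤ |ω|) {n : ℕ} {X₀ Cχ : ℝ} (hX1 : 1 ≤ X₀) (hC : 0 ≤ Cχ)
    (hX : ∀ l ≤ n + 1, ∀ x : ℝ, ‖iteratedFDeriv ℝ l salmhoferCutoff x‖ ≤ X₀ * ((l ! : ℝ)) ^ 2 * Cχ ^ l) {u v : E → ℝ} (hu : ContDiff ℝ (⊤ : ℕ∞) u)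
    (hv : ContDiff ℝ (⊤ : ℕ∞) v) {Eu Fv δ : ℝ} (hEu : 0 ≤ Eu) (hFv : 0 ≤ Fv) (hδ : 0 ≤ δ) (p : E)
    (hDu : ∀ i, 1 ≤ i → i ≤ n → ‖iteratedFDeriv ℝ i u p‖ ≤ i ! * Eu ^ i) (hDv : ∀ i ≤ n, ‖iteratedFDeriv ℝ i v p‖ ≤ δ * i ! * Fv ^ i) :
    ‖iteratedFDeriv ℝ n (fun q : E => ((uvWeightFn Λ ω (u q) : ℝ) : ℂ) * resolventFnXi c 0 ω (u q + uvWeightFn Λ ω (u q) * v q) -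
        uvSymbolFnXi c Λ ω (u q + v q)) p‖ ≤
      δ * (X₀ * (|c| * (4 / Λ)) * ((X₀ + 1) * (4 / Λ) + 16 * (1 + Cχ) / Λ)) * ((n ! : ℝ)) ^ 2 *
        (2 * (4 * (4 * (Eu + Fv) * (1 + 16 * (1 + Cχ) / Λ * (1 + δ))) +
          4 * (4 * (2 * (4 * Eu * (1 + 16 * (1 + Cχ) / Λ * 1) + Fv)) * (1 + 4 / Λ * (1 + δ + (Λ / 128 + X₀ * δ)))) +
          4 * (Eu + Fv) * (1 + 4 / Λ * (1 + δ)) + (4 * Eu * (1 + 16 * (1 + Cχ) / Λ * 1) + Fv))) ^ n := by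
  -- names for the constants
  have hωpos : 0 < |ω| := lt_of_lt_of_le (by positivity) hωΛ
  have hω : ω ≠ 0 := abs_pos.1 hωpos
  have hω0 : ω + 0 ≠ 0 := by rwa [add_zero]
  have hX0 : 0 ≤ X₀ := zero_le_one.trans hX1
  have hτw0 : 0 ≤ (16 * (1 + Cχ) / Λ) := by positivity
  have hτR0 : 0 ≤ (4 / Λ) := by positivity
  have hAR0 : 0 ≤ (|c| * (4 / Λ)) := by positivity
  have hσA0 : 0 ≤ (Eu + Fv) := by positivity
  have hρ₁0 : 0 ≤ (4 * Eu * (1 + 16 * (1 + Cχ) / Λ * 1) + Fv) := by positivity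
  have hBB0 : 0 ≤ (1 + δ + (Λ / 128 + X₀ * δ)) := by positivity
  have hθA0 : 0 ≤ (4 * (Eu + Fv) * (1 + (16 * (1 + Cχ) / Λ) * (1 + δ))) := by positivity
  have hθB0 : 0 ≤ (4 * (2 * (4 * Eu * (1 + 16 * (1 + Cχ) / Λ * 1) + Fv)) * (1 + (4 / Λ) * (1 + δ + (Λ / 128 + X₀ * δ)))) := by positivity
  have hθR0 : 0 ≤ (4 * (Eu + Fv) * (1 + (4 / Λ) * (1 + δ))) := by positivity
  have hρd0 : 0 ≤ (4 * (4 * (Eu + Fv) * (1 + (16 * (1 + Cχ) / Λ) * (1 + δ))) + 4 * (4 * (2 * (4 * Eu * (1 + 16 * (1 + Cχ) / Λ * 1) + Fv)) * (1 + (4 / Λ) * (1 + δ + (Λ / 128 + X₀ * δ)))) + (4 * (Eu + Fv) * (1 + (4 / Λ) * (1 + δ))) + (4 * Eu * (1 + 16 * (1 + Cχ) / Λ * 1) + Fv)) := by positivity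
  have hσAρ₁ : (Eu + Fv) ≤ (4 * Eu * (1 + 16 * (1 + Cχ) / Λ * 1) + Fv) := by
    linarith only [hEu, mul_nonneg hEu hτw0]
  have h4θA : 4 * (4 * (Eu + Fv) * (1 + (16 * (1 + Cχ) / Λ) * (1 + δ))) ≤ (4 * (4 * (Eu + Fv) * (1 + (16 * (1 + Cχ) / Λ) * (1 + δ))) + 4 * (4 * (2 * (4 * Eu * (1 + 16 * (1 + Cχ) / Λ * 1) + Fv)) * (1 + (4 / Λ) * (1 + δ + (Λ / 128 + X₀ * δ)))) + (4 * (Eu + Fv) * (1 + (4 / Λ) * (1 + δ))) + (4 * Eu * (1 + 16 * (1 + Cχ) / Λ * 1) + Fv)) := by linarith only [hθB0, hθR0, hρ₁0]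
  have h4θB : 4 * (4 * (2 * (4 * Eu * (1 + 16 * (1 + Cχ) / Λ * 1) + Fv)) * (1 + (4 / Λ) * (1 + δ + (Λ / 128 + X₀ * δ)))) ≤ (4 * (4 * (Eu + Fv) * (1 + (16 * (1 + Cχ) / Λ) * (1 + δ))) + 4 * (4 * (2 * (4 * Eu * (1 + 16 * (1 + Cχ) / Λ * 1) + Fv)) * (1 + (4 / Λ) * (1 + δ + (Λ / 128 + X₀ * δ)))) + (4 * (Eu + Fv) * (1 + (4 / Λ) * (1 + δ))) + (4 * Eu * (1 + 16 * (1 + Cχ) / Λ * 1) + Fv)) := by linarith only [hθA0, hθR0, hρ₁0]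
  have hθRρ : (4 * (Eu + Fv) * (1 + (4 / Λ) * (1 + δ))) ≤ (4 * (4 * (Eu + Fv) * (1 + (16 * (1 + Cχ) / Λ) * (1 + δ))) + 4 * (4 * (2 * (4 * Eu * (1 + 16 * (1 + Cχ) / Λ * 1) + Fv)) * (1 + (4 / Λ) * (1 + δ + (Λ / 128 + X₀ * δ)))) + (4 * (Eu + Fv) * (1 + (4 / Λ) * (1 + δ))) + (4 * Eu * (1 + 16 * (1 + Cχ) / Λ * 1) + Fv)) := by linarith only [hθA0, hθB0, hρ₁0]
  have hρ₁ρ : (4 * Eu * (1 + 16 * (1 + Cχ) / Λ * 1) + Fv) ≤ (4 * (4 * (Eu + Fv) * (1 + (16 * (1 + Cχ) / Λ) * (1 + δ))) + 4 * (4 * (2 * (4 * Eu * (1 + 16 * (1 + Cχ) / Λ * 1) + Fv)) * (1 + (4 / Λ) * (1 + δ + (Λ / 128 + X₀ * δ)))) + (4 * (Eu + Fv) * (1 + (4 / Λ) * (1 + δ))) + (4 * Eu * (1 + 16 * (1 + Cχ) / Λ * 1) + Fv)) := by linarith only [hθA0, hθB0, hθR0]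
  have hnN : ((n : ℕ∞) : WithTop ℕ∞) ≤ ((⊤ : ℕ∞) : WithTop ℕ∞) := by exact_mod_cast le_top
  -- smoothness of the pieces
  have hwR : ContDiff ℝ (⊤ : ℕ∞) (fun t : ℝ => uvWeightFn Λ ω t) := contDiff_uvWeightFn_band Λ ω
  have hwu : ContDiff ℝ (⊤ : ℕ∞) (fun q : E => uvWeightFn Λ ω (u q)) := hwR.comp hu
  have hR : ContDiff ℝ (⊤ : ℕ∞) (resolventFnXi c 0 ω) := contDiff_resolventFnXi (c := c) hω0
  have hφ : ContDiff ℝ (⊤ : ℕ∞) (fun q : E => u q + uvWeightFn Λ ω (u q) * v q) := hu.add (hwu.mul hv)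
  have huv : ContDiff ℝ (⊤ : ℕ∞) (fun q : E => u q + v q) := hu.add hv
  -- envelopes of the bands at `p`
  have hfac1 : ∀ i : ℕ, (i ! : ℝ) ≤ ((i ! : ℝ)) ^ 2 := fun i => by
    rw [sq]; exact le_mul_of_one_le_left (by positivity) (by exact_mod_cast Nat.one_le_iff_ne_zero.2 (Nat.factorial_ne_zero i))
  have hDuv : ∀ i, 1 ≤ i → i ≤ n → ‖iteratedFDeriv ℝ i (fun q : E => u q + v q) p‖ ≤ (1 + δ) * ((i ! : ℝ)) ^ 2 * (Eu + Fv) ^ i := by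
    intro i hi1 hin
    have hiN : ((i : ℕ∞) : WithTop ℕ∞) ≤ ((⊤ : ℕ∞) : WithTop ℕ∞) := by exact_mod_cast le_top
    rw [fun_iteratedFDeriv_add_apply (hu.contDiffAt.of_le hiN) (hv.contDiffAt.of_le hiN)]
    refine (norm_add_le _ _).trans ?_
    have h1 := hDu i hi1 hin
    have h2 := hDv i hin
    have hEuσ : Eu ^ i ≤ (Eu + Fv) ^ i := pow_le_pow_left₀ hEu (by linarith only [hFv]) i
    have hFvσ : Fv ^ i ≤ (Eu + Fv) ^ i := pow_le_pow_left₀ hFv (by linarith only [hEu]) i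
    have hT1 : (i ! : ℝ) * Eu ^ i ≤ ((i ! : ℝ)) ^ 2 * (Eu + Fv) ^ i := mul_le_mul (hfac1 i) hEuσ (by positivity) (by positivity)
    have hT2 : δ * (i ! : ℝ) * Fv ^ i ≤ δ * (((i ! : ℝ)) ^ 2 * (Eu + Fv) ^ i) := by
      rw [mul_assoc]; exact mul_le_mul_of_nonneg_left (mul_le_mul (hfac1 i) hFvσ (by positivity) (by positivity)) hδ
    calc ‖iteratedFDeriv ℝ i u p‖ + ‖iteratedFDeriv ℝ i v p‖
        ≤ ((i ! : ℝ)) ^ 2 * (Eu + Fv) ^ i + δ * (((i ! : ℝ)) ^ 2 * (Eu + Fv) ^ i) := add_le_add (h1.trans hT1) (h2.trans hT2)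
      _ = (1 + δ) * ((i ! : ℝ)) ^ 2 * (Eu + Fv) ^ i := by ring
  have hDu' : ∀ i, 1 ≤ i → i ≤ n → ‖iteratedFDeriv ℝ i u p‖ ≤ (1 + δ) * ((i ! : ℝ)) ^ 2 * (Eu + Fv) ^ i := by
    intro i hi1 hin
    refine (hDu i hi1 hin).trans ?_
    have hEuσ : Eu ^ i ≤ (Eu + Fv) ^ i := pow_le_pow_left₀ hEu (by linarith only [hFv]) i
    calc (i ! : ℝ) * Eu ^ i ≤ ((i ! : ℝ)) ^ 2 * (Eu + Fv) ^ i := mul_le_mul (hfac1 i) hEuσ (by positivity) (by positivity)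
      _ = 1 * ((i ! : ℝ)) ^ 2 * (Eu + Fv) ^ i := by ring
      _ ≤ (1 + δ) * ((i ! : ℝ)) ^ 2 * (Eu + Fv) ^ i :=
          mul_le_mul_of_nonneg_right (mul_le_mul_of_nonneg_right (by linarith only [hδ]) (by positivity)) (by positivity)
  -- TERM A: `w(u) − w(u+v)` (outer `w`, bands `u` and `u+v`, difference `−v`)
  have hψA : ∀ i ≤ n, ‖iteratedFDeriv ℝ i (fun y => u y - (u y + v y)) p‖ ≤ δ * ((i ! : ℝ)) ^ 2 * (Eu + Fv) ^ i := by
    intro i hin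
    have hfun : (fun y => u y - (u y + v y)) = -v := by funext y; simp
    rw [hfun, iteratedFDeriv_neg_apply, norm_neg]
    refine (hDv i hin).trans ?_
    have hFvσ : Fv ^ i ≤ (Eu + Fv) ^ i := pow_le_pow_left₀ hFv (by linarith only [hEu]) i
    calc δ * (i ! : ℝ) * Fv ^ i = δ * ((i ! : ℝ) * Fv ^ i) := by ring
      _ ≤ δ * (((i ! : ℝ)) ^ 2 * (Eu + Fv) ^ i) := mul_le_mul_of_nonneg_left (mul_le_mul (hfac1 i) hFvσ (by positivity) (by positivity)) hδ
      _ = δ * ((i ! : ℝ)) ^ 2 * (Eu + Fv) ^ i := by ring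
  have hDw : ∀ k, 1 ≤ k → k ≤ n + 1 → ∀ y : ℝ, ‖iteratedFDeriv ℝ k (fun t : ℝ => uvWeightFn Λ ω t) y‖ ≤ X₀ * ((k + 0) ! : ℝ) ^ 2 * (16 * (1 + Cχ) / Λ) ^ k := by
    intro k _ hk y
    rw [add_zero]
    exact norm_iteratedFDeriv_uvWeightFn_band_le_gevrey hΛ ω hX1 hC (fun l hl x => hX l (hl.trans hk) x) y
  have hA : ∀ i ≤ n, ‖iteratedFDeriv ℝ i (fun q : E => uvWeightFn Λ ω (u q) - uvWeightFn Λ ω (u q + v q)) p‖ ≤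
      X₀ * (16 * (1 + Cχ) / Λ) * δ * ((i + 0 + 1) ! : ℝ) ^ 2 * (4 * (Eu + Fv) * (1 + (16 * (1 + Cχ) / Λ) * (1 + δ))) ^ i := by
    intro i hin
    have h := norm_iteratedFDeriv_comp_sub_comp_le_of_gevrey_two (F := ℝ) (G := ℝ) (f₀ := fun q : E => u q + v q) (f₁ := u) huv hu p
      (B := 1 + δ) (Bψ := δ) (σ := (Eu + Fv)) (τ := (16 * (1 + Cχ) / Λ)) (by positivity) hδ hσA0 hτw0 i (fun j hj1 hj => hDuv j hj1 (hj.trans hin))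
      (fun j hj1 hj => hDu' j hj1 (hj.trans hin)) (fun j hj => hψA j (hj.trans hin)) (g := fun t : ℝ => uvWeightFn Λ ω t) hwR hX0 0
      (fun k hk1 hk y => hDw k hk1 (by omega) y)
    exact h
  have hA' : ∀ i ≤ n, ‖iteratedFDeriv ℝ i (fun q : E => (((uvWeightFn Λ ω (u q) - uvWeightFn Λ ω (u q + v q) : ℝ)) : ℂ)) p‖ ≤
      X₀ * (16 * (1 + Cχ) / Λ) * δ * ((i ! : ℝ)) ^ 2 * (4 * (4 * (Eu + Fv) * (1 + (16 * (1 + Cχ) / Λ) * (1 + δ))) + 4 * (4 * (2 * (4 * Eu * (1 + 16 * (1 + Cχ) / Λ * 1) + Fv)) * (1 + (4 / Λ) * (1 + δ + (Λ / 128 + X₀ * δ)))) + (4 * (Eu + Fv) * (1 + (4 / Λ) * (1 + δ))) + (4 * Eu * (1 + 16 * (1 + Cχ) / Λ * 1) + Fv)) ^ i := by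
    intro i hin
    have hcast : (fun q : E => (((uvWeightFn Λ ω (u q) - uvWeightFn Λ ω (u q + v q) : ℝ)) : ℂ)) =
        Complex.ofRealLI ∘ (fun q : E => uvWeightFn Λ ω (u q) - uvWeightFn Λ ω (u q + v q)) := rfl
    have hsm : ContDiff ℝ (⊤ : ℕ∞) (fun q : E => uvWeightFn Λ ω (u q) - uvWeightFn Λ ω (u q + v q)) := hwu.sub (hwR.comp huv)
    rw [hcast, Complex.ofRealLI.norm_iteratedFDeriv_comp_left (hsm.contDiffAt.of_le (by exact_mod_cast le_top)) le_rfl]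
    refine (hA i hin).trans ?_
    have hf := sq_factorial_succ_le i
    rw [show i + 0 + 1 = i + 1 by ring]
    have h4 : ((i ! : ℝ)) ^ 2 * 4 ^ i * (4 * (Eu + Fv) * (1 + (16 * (1 + Cχ) / Λ) * (1 + δ))) ^ i ≤ ((i ! : ℝ)) ^ 2 * (4 * (4 * (Eu + Fv) * (1 + (16 * (1 + Cχ) / Λ) * (1 + δ))) + 4 * (4 * (2 * (4 * Eu * (1 + 16 * (1 + Cχ) / Λ * 1) + Fv)) * (1 + (4 / Λ) * (1 + δ + (Λ / 128 + X₀ * δ)))) + (4 * (Eu + Fv) * (1 + (4 / Λ) * (1 + δ))) + (4 * Eu * (1 + 16 * (1 + Cχ) / Λ * 1) + Fv)) ^ i := by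
      rw [mul_assoc, ← mul_pow]
      exact mul_le_mul_of_nonneg_left (pow_le_pow_left₀ (by positivity) h4θA i) (by positivity)
    have hK0 : 0 ≤ X₀ * (16 * (1 + Cχ) / Λ) * δ := by positivity
    calc X₀ * (16 * (1 + Cχ) / Λ) * δ * (((i + 1) ! : ℕ) : ℝ) ^ 2 * (4 * (Eu + Fv) * (1 + (16 * (1 + Cχ) / Λ) * (1 + δ))) ^ i ≤ X₀ * (16 * (1 + Cχ) / Λ) * δ * (((i ! : ℝ)) ^ 2 * 4 ^ i) * (4 * (Eu + Fv) * (1 + (16 * (1 + Cχ) / Λ) * (1 + δ))) ^ i :=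
          mul_le_mul_of_nonneg_right (mul_le_mul_of_nonneg_left hf hK0) (pow_nonneg hθA0 i)
      _ = X₀ * (16 * (1 + Cχ) / Λ) * δ * (((i ! : ℝ)) ^ 2 * 4 ^ i * (4 * (Eu + Fv) * (1 + (16 * (1 + Cχ) / Λ) * (1 + δ))) ^ i) := by ring
      _ ≤ X₀ * (16 * (1 + Cχ) / Λ) * δ * (((i ! : ℝ)) ^ 2 * (4 * (4 * (Eu + Fv) * (1 + (16 * (1 + Cχ) / Λ) * (1 + δ))) + 4 * (4 * (2 * (4 * Eu * (1 + 16 * (1 + Cχ) / Λ * 1) + Fv)) * (1 + (4 / Λ) * (1 + δ + (Λ / 128 + X₀ * δ)))) + (4 * (Eu + Fv) * (1 + (4 / Λ) * (1 + δ))) + (4 * Eu * (1 + 16 * (1 + Cχ) / Λ * 1) + Fv)) ^ i) := mul_le_mul_of_nonneg_left h4 (by positivity)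
      _ = X₀ * (16 * (1 + Cχ) / Λ) * δ * ((i ! : ℝ)) ^ 2 * (4 * (4 * (Eu + Fv) * (1 + (16 * (1 + Cχ) / Λ) * (1 + δ))) + 4 * (4 * (2 * (4 * Eu * (1 + 16 * (1 + Cχ) / Λ * 1) + Fv)) * (1 + (4 / Λ) * (1 + δ + (Λ / 128 + X₀ * δ)))) + (4 * (Eu + Fv) * (1 + (4 / Λ) * (1 + δ))) + (4 * Eu * (1 + 16 * (1 + Cχ) / Λ * 1) + Fv)) ^ i := by ring
  -- TERM B: `R(u + w(u)v) − R(u+v)` (outer `R`, bands `φ` and `u+v`, difference `(w(u) − 1)·v`)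
  have hDφ : ∀ i, 1 ≤ i → i ≤ n → ‖iteratedFDeriv ℝ i (fun q : E => u q + uvWeightFn Λ ω (u q) * v q) p‖ ≤ (1 + δ + (Λ / 128 + X₀ * δ)) * ((i ! : ℝ)) ^ 2 * (2 * (4 * Eu * (1 + 16 * (1 + Cχ) / Λ * 1) + Fv)) ^ i := by
    intro i hi1 hin
    refine (norm_iteratedFDeriv_shiftedBand_le_gevrey hΛ ω hX1 hC (fun l hl x => hX l (by omega) x) hu hv hEu hFv hδ p
      (fun j hj1 hj => hDu j hj1 (hj.trans hin)) (fun j hj => hDv j (hj.trans hin)) hi1).trans ?_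
    exact mul_le_mul_of_nonneg_right (mul_le_mul_of_nonneg_right (by linarith only [hδ]) (by positivity)) (by positivity)
  have hDuvB : ∀ i, 1 ≤ i → i ≤ n → ‖iteratedFDeriv ℝ i (fun q : E => u q + v q) p‖ ≤ (1 + δ + (Λ / 128 + X₀ * δ)) * ((i ! : ℝ)) ^ 2 * (2 * (4 * Eu * (1 + 16 * (1 + Cχ) / Λ * 1) + Fv)) ^ i := by
    intro i hi1 hin
    refine (hDuv i hi1 hin).trans ?_
    have hσ2 : (Eu + Fv) ^ i ≤ (2 * (4 * Eu * (1 + 16 * (1 + Cχ) / Λ * 1) + Fv)) ^ i := pow_le_pow_left₀ hσA0 (hσAρ₁.trans (by linarith only [hρ₁0])) i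
    exact mul_le_mul (mul_le_mul_of_nonneg_right (by linarith only [mul_nonneg hX0 hδ, hΛ]) (by positivity)) hσ2 (by positivity) (by positivity)
  -- the difference `(w(u) − 1)·v`
  have hwm1 : ∀ i ≤ n, ‖iteratedFDeriv ℝ i (fun q : E => uvWeightFn Λ ω (u q) - 1) p‖ ≤ (X₀ + 1) * ((i ! : ℝ)) ^ 2 * (4 * Eu * (1 + 16 * (1 + Cχ) / Λ * 1) + Fv) ^ i := by
    intro i hin
    have hiN : ((i : ℕ∞) : WithTop ℕ∞) ≤ ((⊤ : ℕ∞) : WithTop ℕ∞) := by exact_mod_cast le_top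
    rcases Nat.eq_zero_or_pos i with rfl | hipos
    · rw [norm_iteratedFDeriv_zero]
      have h0 := hX 0 (Nat.zero_le _) (((u p) ^ 2 + ω ^ 2) / Λ ^ 2)
      rw [norm_iteratedFDeriv_zero] at h0
      simp only [Nat.factorial_zero, Nat.cast_one, one_pow, mul_one, pow_zero] at h0 ⊢
      have hw : ‖uvWeightFn Λ ω (u p)‖ ≤ X₀ := by unfold uvWeightFn; exact h0
      calc ‖uvWeightFn Λ ω (u p) - 1‖ ≤ ‖uvWeightFn Λ ω (u p)‖ + ‖(1 : ℝ)‖ := norm_sub_le _ _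
        _ ≤ X₀ + 1 := by rw [norm_one]; exact add_le_add hw le_rfl
    · rw [fun_iteratedFDeriv_sub_apply (hwu.contDiffAt.of_le hiN) (contDiff_const.contDiffAt.of_le hiN),
        iteratedFDeriv_const_of_ne (by omega) (1 : ℝ), Pi.zero_apply, sub_zero]
      refine (norm_iteratedFDeriv_weight_comp_le_gevrey hΛ ω hX1 hC (fun l hl x => hX l (by omega) x) hu hEu p
        (fun j hj1 hj => hDu j hj1 (hj.trans hin))).trans ?_
      have hρw : 4 * Eu * (1 + 16 * (1 + Cχ) / Λ * 1) ≤ (4 * Eu * (1 + 16 * (1 + Cχ) / Λ * 1) + Fv) := by linarith only [hFv]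
      exact mul_le_mul (mul_le_mul_of_nonneg_right (by linarith only) (by positivity)) (pow_le_pow_left₀ (by positivity) hρw i)
        (by positivity) (by positivity)
  have hψB : ∀ i ≤ n, ‖iteratedFDeriv ℝ i (fun y => (u y + uvWeightFn Λ ω (u y) * v y) - (u y + v y)) p‖ ≤ (X₀ + 1) * δ * ((i ! : ℝ)) ^ 2 * (2 * (4 * Eu * (1 + 16 * (1 + Cχ) / Λ * 1) + Fv)) ^ i := by
    intro i hin
    have hfun : (fun y => (u y + uvWeightFn Λ ω (u y) * v y) - (u y + v y)) = fun y => (uvWeightFn Λ ω (u y) - 1) * v y := by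
      funext y; ring
    rw [hfun]
    have hiN : ((i : ℕ∞) : WithTop ℕ∞) ≤ ((⊤ : ℕ∞) : WithTop ℕ∞) := by exact_mod_cast le_top
    have h := norm_iteratedFDeriv_mul_le_of_factorialPow (a := 2) (b := 1) (A := X₀ + 1) (B := δ) (ρ := (4 * Eu * (1 + 16 * (1 + Cχ) / Λ * 1) + Fv)) (hwu.sub contDiff_const) hv hiN p
      (by positivity) hδ hρ₁0 (fun j hj => hwm1 j (hj.trans hin))
      (fun j hj => by
        refine (hDv j (hj.trans hin)).trans ?_
        rw [pow_one]
        exact mul_le_mul_of_nonneg_left (pow_le_pow_left₀ hFv (by linarith only [mul_nonneg (mul_nonneg (by norm_num : (0:ℝ) ≤ 4) hEu) (show (0:ℝ) ≤ 1 + 16 * (1 + Cχ) / Λ * 1 by positivity)]) j) (by positivity))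
    rw [show max 2 1 = 2 by norm_num] at h
    exact h
  have hDR : ∀ k, 1 ≤ k → k ≤ n + 1 → ∀ y : ℝ, ‖iteratedFDeriv ℝ k (resolventFnXi c 0 ω) y‖ ≤ (|c| * (4 / Λ)) * ((k + 0) ! : ℝ) ^ 2 * (4 / Λ) ^ k := by
    intro k _ _ y
    rw [add_zero]
    exact norm_iteratedFDeriv_resolventFnXi_le_gevrey_of_freq hΛ hωΛ k y
  have hB : ∀ i ≤ n, ‖iteratedFDeriv ℝ i (fun q : E => resolventFnXi c 0 ω (u q + uvWeightFn Λ ω (u q) * v q) - resolventFnXi c 0 ω (u q + v q)) p‖ ≤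
      (|c| * (4 / Λ)) * (4 / Λ) * ((X₀ + 1) * δ) * ((i + 0 + 1) ! : ℝ) ^ 2 * (4 * (2 * (4 * Eu * (1 + 16 * (1 + Cχ) / Λ * 1) + Fv)) * (1 + (4 / Λ) * (1 + δ + (Λ / 128 + X₀ * δ)))) ^ i := by
    intro i hin
    have h := norm_iteratedFDeriv_comp_sub_comp_le_of_gevrey_two (F := ℝ) (G := ℂ) (f₀ := fun q : E => u q + v q)
      (f₁ := fun q : E => u q + uvWeightFn Λ ω (u q) * v q) huv hφ p (B := (1 + δ + (Λ / 128 + X₀ * δ))) (Bψ := (X₀ + 1) * δ) (σ := 2 * (4 * Eu * (1 + 16 * (1 + Cχ) / Λ * 1) + Fv)) (τ := (4 / Λ)) hBB0 (by positivity)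
      (by positivity) hτR0 i (fun j hj1 hj => hDuvB j hj1 (hj.trans hin)) (fun j hj1 hj => hDφ j hj1 (hj.trans hin))
      (fun j hj => hψB j (hj.trans hin)) (g := resolventFnXi c 0 ω) hR hAR0 0 (fun k hk1 hk y => hDR k hk1 (by omega) y)
    exact h
  have hB' : ∀ i ≤ n, ‖iteratedFDeriv ℝ i (fun q : E => resolventFnXi c 0 ω (u q + uvWeightFn Λ ω (u q) * v q) - resolventFnXi c 0 ω (u q + v q)) p‖ ≤
      (|c| * (4 / Λ)) * (4 / Λ) * ((X₀ + 1) * δ) * ((i ! : ℝ)) ^ 2 * (4 * (4 * (Eu + Fv) * (1 + (16 * (1 + Cχ) / Λ) * (1 + δ))) + 4 * (4 * (2 * (4 * Eu * (1 + 16 * (1 + Cχ) / Λ * 1) + Fv)) * (1 + (4 / Λ) * (1 + δ + (Λ / 128 + X₀ * δ)))) + (4 * (Eu + Fv) * (1 + (4 / Λ) * (1 + δ))) + (4 * Eu * (1 + 16 * (1 + Cχ) / Λ * 1) + Fv)) ^ i := by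
    intro i hin
    refine (hB i hin).trans ?_
    have hf := sq_factorial_succ_le i
    rw [show i + 0 + 1 = i + 1 by ring]
    have h4 : ((i ! : ℝ)) ^ 2 * 4 ^ i * (4 * (2 * (4 * Eu * (1 + 16 * (1 + Cχ) / Λ * 1) + Fv)) * (1 + (4 / Λ) * (1 + δ + (Λ / 128 + X₀ * δ)))) ^ i ≤ ((i ! : ℝ)) ^ 2 * (4 * (4 * (Eu + Fv) * (1 + (16 * (1 + Cχ) / Λ) * (1 + δ))) + 4 * (4 * (2 * (4 * Eu * (1 + 16 * (1 + Cχ) / Λ * 1) + Fv)) * (1 + (4 / Λ) * (1 + δ + (Λ / 128 + X₀ * δ)))) + (4 * (Eu + Fv) * (1 + (4 / Λ) * (1 + δ))) + (4 * Eu * (1 + 16 * (1 + Cχ) / Λ * 1) + Fv)) ^ i := by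
      rw [mul_assoc, ← mul_pow]
      exact mul_le_mul_of_nonneg_left (pow_le_pow_left₀ (by positivity) h4θB i) (by positivity)
    have hK0 : 0 ≤ (|c| * (4 / Λ)) * (4 / Λ) * ((X₀ + 1) * δ) := by positivity
    calc (|c| * (4 / Λ)) * (4 / Λ) * ((X₀ + 1) * δ) * (((i + 1) ! : ℕ) : ℝ) ^ 2 * (4 * (2 * (4 * Eu * (1 + 16 * (1 + Cχ) / Λ * 1) + Fv)) * (1 + (4 / Λ) * (1 + δ + (Λ / 128 + X₀ * δ)))) ^ i ≤ (|c| * (4 / Λ)) * (4 / Λ) * ((X₀ + 1) * δ) * (((i ! : ℝ)) ^ 2 * 4 ^ i) * (4 * (2 * (4 * Eu * (1 + 16 * (1 + Cχ) / Λ * 1) + Fv)) * (1 + (4 / Λ) * (1 + δ + (Λ / 128 + X₀ * δ)))) ^ i :=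
          mul_le_mul_of_nonneg_right (mul_le_mul_of_nonneg_left hf hK0) (pow_nonneg hθB0 i)
      _ = (|c| * (4 / Λ)) * (4 / Λ) * ((X₀ + 1) * δ) * (((i ! : ℝ)) ^ 2 * 4 ^ i * (4 * (2 * (4 * Eu * (1 + 16 * (1 + Cχ) / Λ * 1) + Fv)) * (1 + (4 / Λ) * (1 + δ + (Λ / 128 + X₀ * δ)))) ^ i) := by ring
      _ ≤ (|c| * (4 / Λ)) * (4 / Λ) * ((X₀ + 1) * δ) * (((i ! : ℝ)) ^ 2 * (4 * (4 * (Eu + Fv) * (1 + (16 * (1 + Cχ) / Λ) * (1 + δ))) + 4 * (4 * (2 * (4 * Eu * (1 + 16 * (1 + Cχ) / Λ * 1) + Fv)) * (1 + (4 / Λ) * (1 + δ + (Λ / 128 + X₀ * δ)))) + (4 * (Eu + Fv) * (1 + (4 / Λ) * (1 + δ))) + (4 * Eu * (1 + 16 * (1 + Cχ) / Λ * 1) + Fv)) ^ i) := mul_le_mul_of_nonneg_left h4 hK0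
      _ = (|c| * (4 / Λ)) * (4 / Λ) * ((X₀ + 1) * δ) * ((i ! : ℝ)) ^ 2 * (4 * (4 * (Eu + Fv) * (1 + (16 * (1 + Cχ) / Λ) * (1 + δ))) + 4 * (4 * (2 * (4 * Eu * (1 + 16 * (1 + Cχ) / Λ * 1) + Fv)) * (1 + (4 / Λ) * (1 + δ + (Λ / 128 + X₀ * δ)))) + (4 * (Eu + Fv) * (1 + (4 / Λ) * (1 + δ))) + (4 * Eu * (1 + 16 * (1 + Cχ) / Λ * 1) + Fv)) ^ i := by ring
  -- the two bounded factors: `w(u)` and `R(u+v)`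
  have hWu : ∀ i ≤ n, ‖iteratedFDeriv ℝ i (fun q : E => ((uvWeightFn Λ ω (u q) : ℝ) : ℂ)) p‖ ≤ X₀ * ((i ! : ℝ)) ^ 2 * (4 * (4 * (Eu + Fv) * (1 + (16 * (1 + Cχ) / Λ) * (1 + δ))) + 4 * (4 * (2 * (4 * Eu * (1 + 16 * (1 + Cχ) / Λ * 1) + Fv)) * (1 + (4 / Λ) * (1 + δ + (Λ / 128 + X₀ * δ)))) + (4 * (Eu + Fv) * (1 + (4 / Λ) * (1 + δ))) + (4 * Eu * (1 + 16 * (1 + Cχ) / Λ * 1) + Fv)) ^ i := by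
    intro i hin
    have hcast : (fun q : E => ((uvWeightFn Λ ω (u q) : ℝ) : ℂ)) = Complex.ofRealLI ∘ (fun q : E => uvWeightFn Λ ω (u q)) := rfl
    rw [hcast, Complex.ofRealLI.norm_iteratedFDeriv_comp_left (hwu.contDiffAt.of_le (by exact_mod_cast le_top)) le_rfl]
    refine (norm_iteratedFDeriv_weight_comp_le_gevrey hΛ ω hX1 hC (fun l hl x => hX l (by omega) x) hu hEu p
      (fun j hj1 hj => hDu j hj1 (hj.trans hin))).trans ?_
    have hρw : 4 * Eu * (1 + 16 * (1 + Cχ) / Λ * 1) ≤ (4 * (4 * (Eu + Fv) * (1 + (16 * (1 + Cχ) / Λ) * (1 + δ))) + 4 * (4 * (2 * (4 * Eu * (1 + 16 * (1 + Cχ) / Λ * 1) + Fv)) * (1 + (4 / Λ) * (1 + δ + (Λ / 128 + X₀ * δ)))) + (4 * (Eu + Fv) * (1 + (4 / Λ) * (1 + δ))) + (4 * Eu * (1 + 16 * (1 + Cχ) / Λ * 1) + Fv)) := by linarith only [hFv, hθA0, hθB0, hθR0]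
    exact mul_le_mul_of_nonneg_left (pow_le_pow_left₀ (by positivity) hρw i) (by positivity)
  have hRuv : ∀ i ≤ n, ‖iteratedFDeriv ℝ i (fun q : E => resolventFnXi c 0 ω (u q + v q)) p‖ ≤ (|c| * (4 / Λ)) * ((i ! : ℝ)) ^ 2 * (4 * (4 * (Eu + Fv) * (1 + (16 * (1 + Cχ) / Λ) * (1 + δ))) + 4 * (4 * (2 * (4 * Eu * (1 + 16 * (1 + Cχ) / Λ * 1) + Fv)) * (1 + (4 / Λ) * (1 + δ + (Λ / 128 + X₀ * δ)))) + (4 * (Eu + Fv) * (1 + (4 / Λ) * (1 + δ))) + (4 * Eu * (1 + 16 * (1 + Cχ) / Λ * 1) + Fv)) ^ i := by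
    intro i hin
    have hcomp : (fun q : E => resolventFnXi c 0 ω (u q + v q)) = resolventFnXi c 0 ω ∘ (fun q => u q + v q) := rfl
    rw [hcomp]
    have h := norm_iteratedFDeriv_comp_le_of_gevrey_two (F := ℝ) (G := ℂ) huv p (B := 1 + δ) (σ := (Eu + Fv)) (τ := (4 / Λ)) (by positivity) hσA0 hτR0 i
      (fun j hj1 hj => hDuv j hj1 (hj.trans hin)) hR (|c| * (4 / Λ)) 0
      (fun k hk => by rw [add_zero]; exact norm_iteratedFDeriv_resolventFnXi_le_gevrey_of_freq hΛ hωΛ k _)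
    rw [add_zero] at h
    refine h.trans ?_
    exact mul_le_mul_of_nonneg_left (pow_le_pow_left₀ hθR0 hθRρ i) (by positivity)
  -- the two products and the split `d = w(u)·[R(φ) − R(u+v)] + [w(u) − w(u+v)]·R(u+v)`
  have hsmB : ContDiff ℝ (⊤ : ℕ∞) (fun q : E => resolventFnXi c 0 ω (u q + uvWeightFn Λ ω (u q) * v q) - resolventFnXi c 0 ω (u q + v q)) :=
    (hR.comp hφ).sub (hR.comp huv)
  have hsmW : ContDiff ℝ (⊤ : ℕ∞) (fun q : E => ((uvWeightFn Λ ω (u q) : ℝ) : ℂ)) := Complex.ofRealCLM.contDiff.comp hwu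
  have hsmA : ContDiff ℝ (⊤ : ℕ∞) (fun q : E => (((uvWeightFn Λ ω (u q) - uvWeightFn Λ ω (u q + v q) : ℝ)) : ℂ)) :=
    Complex.ofRealCLM.contDiff.comp (hwu.sub (hwR.comp huv))
  have hsmR : ContDiff ℝ (⊤ : ℕ∞) (fun q : E => resolventFnXi c 0 ω (u q + v q)) := hR.comp huv
  have hP1 := norm_iteratedFDeriv_mul_le_of_factorialPow (a := 2) (b := 2) (A := X₀) (B := (|c| * (4 / Λ)) * (4 / Λ) * ((X₀ + 1) * δ)) (ρ := (4 * (4 * (Eu + Fv) * (1 + (16 * (1 + Cχ) / Λ) * (1 + δ))) + 4 * (4 * (2 * (4 * Eu * (1 + 16 * (1 + Cχ) / Λ * 1) + Fv)) * (1 + (4 / Λ) * (1 + δ + (Λ / 128 + X₀ * δ)))) + (4 * (Eu + Fv) * (1 + (4 / Λ) * (1 + δ))) + (4 * Eu * (1 + 16 * (1 + Cχ) / Λ * 1) + Fv)))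
    hsmW hsmB hnN p hX0 (by positivity) hρd0 hWu hB'
  have hP2 := norm_iteratedFDeriv_mul_le_of_factorialPow (a := 2) (b := 2) (A := X₀ * (16 * (1 + Cχ) / Λ) * δ) (B := (|c| * (4 / Λ))) (ρ := (4 * (4 * (Eu + Fv) * (1 + (16 * (1 + Cχ) / Λ) * (1 + δ))) + 4 * (4 * (2 * (4 * Eu * (1 + 16 * (1 + Cχ) / Λ * 1) + Fv)) * (1 + (4 / Λ) * (1 + δ + (Λ / 128 + X₀ * δ)))) + (4 * (Eu + Fv) * (1 + (4 / Λ) * (1 + δ))) + (4 * Eu * (1 + 16 * (1 + Cχ) / Λ * 1) + Fv)))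
    hsmA hsmR hnN p (by positivity) hAR0 hρd0 hA' hRuv
  rw [max_self] at hP1 hP2
  have hsplit : (fun q : E => ((uvWeightFn Λ ω (u q) : ℝ) : ℂ) * resolventFnXi c 0 ω (u q + uvWeightFn Λ ω (u q) * v q) -
      uvSymbolFnXi c Λ ω (u q + v q)) = fun q =>
      (fun q : E => ((uvWeightFn Λ ω (u q) : ℝ) : ℂ)) q *
          (fun q : E => resolventFnXi c 0 ω (u q + uvWeightFn Λ ω (u q) * v q) - resolventFnXi c 0 ω (u q + v q)) q +
        (fun q : E => (((uvWeightFn Λ ω (u q) - uvWeightFn Λ ω (u q + v q) : ℝ)) : ℂ)) q * (fun q : E => resolventFnXi c 0 ω (u q + v q)) q := by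
    funext q
    simp only [uvSymbolFnXi]
    push_cast
    ring
  rw [hsplit, fun_iteratedFDeriv_add_apply ((hsmW.mul hsmB).contDiffAt.of_le hnN) ((hsmA.mul hsmR).contDiffAt.of_le hnN)]
  refine (norm_add_le _ _).trans ?_
  calc ‖iteratedFDeriv ℝ n (fun q => (fun q : E => ((uvWeightFn Λ ω (u q) : ℝ) : ℂ)) q *
          (fun q : E => resolventFnXi c 0 ω (u q + uvWeightFn Λ ω (u q) * v q) - resolventFnXi c 0 ω (u q + v q)) q) p‖ +
        ‖iteratedFDeriv ℝ n (fun q => (fun q : E => (((uvWeightFn Λ ω (u q) - uvWeightFn Λ ω (u q + v q) : ℝ)) : ℂ)) q *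
          (fun q : E => resolventFnXi c 0 ω (u q + v q)) q) p‖
      ≤ X₀ * ((|c| * (4 / Λ)) * (4 / Λ) * ((X₀ + 1) * δ)) * ((n ! : ℝ)) ^ 2 * (2 * (4 * (4 * (Eu + Fv) * (1 + (16 * (1 + Cχ) / Λ) * (1 + δ))) + 4 * (4 * (2 * (4 * Eu * (1 + 16 * (1 + Cχ) / Λ * 1) + Fv)) * (1 + (4 / Λ) * (1 + δ + (Λ / 128 + X₀ * δ)))) + (4 * (Eu + Fv) * (1 + (4 / Λ) * (1 + δ))) + (4 * Eu * (1 + 16 * (1 + Cχ) / Λ * 1) + Fv))) ^ n + X₀ * (16 * (1 + Cχ) / Λ) * δ * (|c| * (4 / Λ)) * ((n ! : ℝ)) ^ 2 * (2 * (4 * (4 * (Eu + Fv) * (1 + (16 * (1 + Cχ) / Λ) * (1 + δ))) + 4 * (4 * (2 * (4 * Eu * (1 + 16 * (1 + Cχ) / Λ * 1) + Fv)) * (1 + (4 / Λ) * (1 + δ + (Λ / 128 + X₀ * δ)))) + (4 * (Eu + Fv) * (1 + (4 / Λ) * (1 + δ))) + (4 * Eu * (1 + 16 * (1 + Cχ)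 / Λ * 1) + Fv))) ^ n :=
        add_le_add hP1 hP2
    _ = δ * (X₀ * (|c| * (4 / Λ)) * ((X₀ + 1) * (4 / Λ) + (16 * (1 + Cχ) / Λ))) * ((n ! : ℝ)) ^ 2 * (2 * (4 * (4 * (Eu + Fv) * (1 + (16 * (1 + Cχ) / Λ) * (1 + δ))) + 4 * (4 * (2 * (4 * Eu * (1 + 16 * (1 + Cχ) / Λ * 1) + Fv)) * (1 + (4 / Λ) * (1 + δ + (Λ / 128 + X₀ * δ)))) + (4 * (Eu + Fv) * (1 + (4 / Λ) * (1 + δ))) + (4 * Eu * (1 + 16 * (1 + Cχ) / Λ * 1) + Fv))) ^ n := by ring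

end Jets

end Literature.MathematicalPhysics.QuantumLattice

end
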